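import Summits.ResolutionOfSingularities.ResolutionOfSingularities.Theorems.CurveBranchKernel
import HarnessLib

/-!
# CurveBranchPort — «CurveBranchLaw» FILE B (decomp-res lens-4, g44): PRIME CURVES (§156′), RE-BASE (§157), MATSUMURA BRIDGE (§158), THE LOCATED RESIDUAL F,
# THE CELLS AND THE EXACT CARVE OF THE PORT `hC : MaxContactCut.CurveLawAll` (§159)

Second slice of the g44 node «CurveBranchLaw» (node header: `Theorems/CurveBranchKernel.lean`).  §156′: `primeCurveHugging_of_curveHugging`
(a tower hugging a one-dimensional germ hugs an INTEGRAL CURVE germ — the pigeonhole law of FILE A at a minimal prime).  §157: a germ hugged from stage `m` is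
hugged from stage `m + j` by its `j`-th strict transform (`hugsGerm_strictIter`; the ℕ-index transport done once by `HEq`).  §158: a
regular one-dimensional quotient of the (regular) marked stalk by a hugged stalk is a regular curve FRAME (Literature
`exists_rsop_of_isRegularLocalRing_quotient`, Matsumura 14.2, BY NAME); a non-zero hugged stalk with one-dimensional quotient forces ring
dimension `≥ 2` at every marked point.  §159: F = `HuggedBranchResolution` (print statement in its docstring; KNOWN IN PRINT · UNDECIDED
IN THE TREE); the DECIDED cell `EventuallyRegularBranchHugging` KILLED hypothesis-free for every class and weight `n ≥ 1`
(`noTower_eventuallyRegularBranchHugging`: bridge + re-base + LAW R; the frame of length 0 is excluded by the dimension count); the located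
residual cell `SingularBranchCurveHugging` / `SingularBranchCurveLawAll` (over `NoTower` BY NAME); the EXACT CARVE
`curveLawAll_iff_g44 : MaxContactCut.CurveLawAll ↔ SingularBranchCurveLawAll` (zero binders) and
`curveLawAll_of_huggedBranchResolution : HuggedBranchResolution → MaxContactCut.CurveLawAll`.
HONEST SCOPE: the port `hC` is RE-TYPED, not discharged; `HuggedBranchResolution` quantifies over all lens-6 branches hugging an
integral curve germ (a habitat larger than the residual cell — it is the natural print statement); the isolation kill and LAW R are glue on
lens-6's paid law (ROW 128), the NEW content is the prime-component pigeonhole, the eventually-regular kill along SINGULAR hugged germs and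
the exact re-location.
AI-written; AI review weaker than expert review.  `MaxContactCut.NoForcedTowers` (30253) is NOT proved; `MaxContactCut.CurveLawAll`
(32207) is NOT proved — it is RE-TYPED em-exactly onto its located residual `HuggedBranchResolution` (KNOWN IN PRINT · UNDECIDED IN THE
TREE; discharging it from the Literature δ-engine is the announced g45 stage, not claimed here).  No named facts, no ports, no sorry.
-/

noncomputable section

set_option linter.dupNamespace false

open CategoryTheory CategoryTheory.Limits AlgebraicGeometry TopologicalSpace IsLocalRing
open Literature.AlgebraicGeometry.Resolution Scheme.IdealSheafData
open Summit.ResolutionOfSingularities.ResolutionOfSingularities.Theorems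
open WeakOrderReduction ForcedTowerClasses DivergentTowerClasses MonomialTowerClasses
open HugDimensionClasses HugDimensionKernels SurfaceShadowClasses SurfaceShadowKernels AbsoluteContactClasses

namespace Summit.ResolutionOfSingularities.ResolutionOfSingularities.Theorems.HugValuationCut

universe u

variable {k : Type} [Field k]

/-! ## ══ FILE B `Theorems/CurveBranchPort.lean` (§156′–§159; imports FILE A) ══ -/

/-! ## §156′ (g44 · PRIME CURVES) a minimal prime of a germ with one-dimensional quotient is an integral CURVE germ; curve hugging ⟹ PRIME
curve hugging (the pigeonhole law of FILE A). -/

section PrimeCurve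

/-- a MINIMAL PRIME of an ideal `I` of a local ring with `dim R/I = 1` has `dim R/P = 1` (and is not the maximal ideal). [folklore] -/
theorem ringKrullDim_quotient_eq_one_of_minimalPrimes {R : Type*} [CommRing R] [IsLocalRing R] {I P : Ideal R}
    (hP : P ∈ I.minimalPrimes) (h : ringKrullDim (R ⧸ I) = 1) : ringKrullDim (R ⧸ P) = 1 := by
  haveI : P.IsPrime := hP.1.1
  have hne : P ≠ maximalIdeal R := by
    obtain ⟨P', hP', hIP', hP'ne⟩ := exists_prime_le_ne_maximalIdeal_of_ringKrullDim_quotient_eq_one h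
    intro hPm
    have h1 : P ≤ P' := hP.2 ⟨hP', hIP'⟩ (hPm ▸ IsLocalRing.le_maximalIdeal hP'.ne_top)
    exact hP'ne (le_antisymm (IsLocalRing.le_maximalIdeal hP'.ne_top) (hPm ▸ h1))
  refine le_antisymm ?_ ?_
  · rw [← h]
    exact ringKrullDim_le_of_surjective (Ideal.Quotient.factor hP.1.2) (Ideal.Quotient.factor_surjective hP.1.2)
  · rw [ringKrullDim_quotient, Order.one_le_krullDim_iff]
    refine ⟨⟨⟨P, hP.1.1⟩, (PrimeSpectrum.mem_zeroLocus _ _).mpr le_rfl⟩,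
      ⟨IsLocalRing.closedPoint R, (PrimeSpectrum.mem_zeroLocus _ _).mpr (IsLocalRing.le_maximalIdeal hP.1.1.ne_top)⟩, ?_⟩
    exact Subtype.mk_lt_mk.mpr ((PrimeSpectrum.asIdeal_lt_asIdeal _ _).mp
      (lt_of_le_of_ne (IsLocalRing.le_maximalIdeal hP.1.1.ne_top) hne))

/-- **PRIME CURVE HUGGING**: the tower hugs forever the germ of a sheaf whose stalk at `pt m` is a PRIME with one-dimensional quotient
(the germ of an integral curve through `pt m`). -/
def PrimeCurveHugging (T : ForcedTower) : Prop :=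
  ∃ (m : ℕ) (H : (T.St m).IdealSheafData), DivergentTowerClasses.HugsGerm T m H ∧ (stalkIdeal H (T.pt m)).IsPrime ∧
    ringKrullDim ((T.St m).presheaf.stalk (T.pt m) ⧸ stalkIdeal H (T.pt m)) = 1

/-- **`CurveHugging → PrimeCurveHugging`** (the pigeonhole law through the adapter). [NEW] -/
theorem primeCurveHugging_of_curveHugging (T : ForcedTower) (g : T.St 0 ⟶ Spec (.of k)) (hB : IsBase (T.St 0) g)
    (h : CurveHugging T) : PrimeCurveHugging T := by
  obtain ⟨m, H, hH, hdim⟩ := h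
  obtain ⟨q, hq, hHug⟩ := exists_hugsGerm_minimalPrime (toBranch T g hB) m ((hugsGerm_toBranch T g hB m H).mpr hH)
  refine ⟨m, primeGerm (toBranch T g hB) m q, (hugsGerm_toBranch T g hB m _).mp hHug, ?_, ?_⟩
  · show (stalkIdeal (primeGerm (toBranch T g hB) m q) ((toBranch T g hB).pt m)).IsPrime
    rw [stalkIdeal_primeGerm]
    exact q.2
  · show ringKrullDim (((toBranch T g hB).St m).presheaf.stalk ((toBranch T g hB).pt m) ⧸
      stalkIdeal (primeGerm (toBranch T g hB) m q) ((toBranch T g hB).pt m)) = 1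
    rw [stalkIdeal_primeGerm]
    have hdim' : ringKrullDim ((T.St m).presheaf.stalk (T.pt m) ⧸ stalkIdeal H (T.pt m)) = 1 := by simpa using hdim
    exact ringKrullDim_quotient_eq_one_of_minimalPrimes hq hdim'

/-- `PrimeCurveHugging → CurveHugging` (letters). [folklore] -/
theorem curveHugging_of_primeCurveHugging (T : ForcedTower) (h : PrimeCurveHugging T) : CurveHugging T := by
  obtain ⟨m, H, hH, -, hdim⟩ := h
  exact ⟨m, H, hH, by simpa using hdim⟩

end PrimeCurve

/-! ## §157 (g44 · RE-BASE) a germ hugged from stage `m` is hugged from stage `m + j` by its `j`-th strict transform (ℕ-index transport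
`m + j + i = m + (j + i)` done once, by `HEq` along a variable stage index). -/

section Rebase

variable (B : SatelliteExitClasses.Branch k)

/-- Strict transforms along a branch at (propositionally) equal stages of equal ideal sheaves are `HEq`. -/
theorem heq_strictTransformIdeal {a b : ℕ} (e : a = b) {I : (B.St a).IdealSheafData} {I' : (B.St b).IdealSheafData}
    (h : HEq I I') : HEq (strictTransformIdeal (B.π a) (B.centre a) I) (strictTransformIdeal (B.π b) (B.centre b) I') := by
  subst e
  rw [heq_iff_eq] at h
  subst h
  rfl

/-- `strictIter` is additive in the stage: the `i`-th strict transform from stage `m + j` of the `j`-th strict transform is the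
`(j + i)`-th strict transform (as `HEq`, the stages being `m + j + i` and `m + (j + i)`). [folklore] -/
theorem strictIter_add_heq (m : ℕ) (H : (B.St m).IdealSheafData) (j : ℕ) :
    ∀ i, HEq (SatelliteExitClasses.strictIter B (m + j) (SatelliteExitClasses.strictIter B m H j) i)
      (SatelliteExitClasses.strictIter B m H (j + i))
  | 0 => HEq.rfl
  | i + 1 => heq_strictTransformIdeal B (Nat.add_assoc m j i) (strictIter_add_heq m H j i)

/-- transport of a stage-indexed property along `HEq`. [folklore] -/
theorem iff_of_heq (P : ∀ c : ℕ, (B.St c).IdealSheafData → Prop) {a b : ℕ} (e : a = b) {I : (B.St a).IdealSheafData}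
    {I' : (B.St b).IdealSheafData} (h : HEq I I') : P a I ↔ P b I' := by
  subst e
  rw [heq_iff_eq] at h
  subst h
  exact Iff.rfl

/-- **RE-BASE**: a germ hugged from stage `m` whose `j`-th strict transform still has a non-zero stalk at the followed point is hugged
from stage `m + j` by that strict transform. [folklore] -/
theorem hugsGerm_strictIter {m : ℕ} {H : (B.St m).IdealSheafData} (hH : SatelliteExitClasses.HugsGerm B m H) (j : ℕ)
    (hfin : idealOrder (SatelliteExitClasses.strictIter B m H j) (B.pt (m + j)) ≠ ⊤) :
    SatelliteExitClasses.HugsGerm B (m + j) (SatelliteExitClasses.strictIter B m H j) :=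
  ⟨hfin, fun i => (iff_of_heq B (fun c I => B.pt c ∈ (I.support : Set (B.St c))) (Nat.add_assoc m j i)
    (strictIter_add_heq B m H j i)).mpr (hH.2 (j + i))⟩

end Rebase

/-! ## §158 (g44 · MATSUMURA BRIDGE AND DIMENSION BOOKKEEPING) a regular one-dimensional quotient of the regular stalk by a hugged stalk
is a regular curve FRAME (Literature `exists_rsop_of_isRegularLocalRing_quotient`, Matsumura 14.2, BY NAME); a non-zero ideal with
one-dimensional quotient forces ring dimension `≥ 2`. -/

section Bridge

/-- **Matsumura 14.2, packaged**: an ideal `J ⊆ 𝔪` of a regular local ring with regular quotient is generated by a PART of a regular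
system of parameters. [cite: Matsumura1987, Thm. 14.2] -/
theorem exists_isRsopPart_of_isRegularLocalRing_quotient {R : Type*} [CommRing R] [IsRegularLocalRing R] {J : Ideal R}
    (hJ : J ≤ maximalIdeal R) [IsRegularLocalRing (R ⧸ J)] :
    ∃ (r : ℕ) (w : Fin r → R), IsRsopPart w ∧ J = Ideal.span (Set.range w) := by
  classical
  obtain ⟨u, hu, S, hJS⟩ := exists_rsop_of_isRegularLocalRing_quotient hJ
  set s : Finset (Fin (maximalIdeal R).spanFinrank) := S.toFinset with hs
  let e : {x // x ∈ s} ≃ Fin s.card := s.equivFin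
  let ι : Fin s.card → Fin (maximalIdeal R).spanFinrank := fun i => (e.symm i).1
  have hι : Function.Injective ι := fun a b h => e.symm.injective (Subtype.ext h)
  refine ⟨s.card, u ∘ ι, isRsopPart_comp_of_rsop rfl u hu ι hι, ?_⟩
  rw [hJS]
  congr 1
  ext a
  constructor
  · rintro ⟨x, hx, rfl⟩
    have hx' : x ∈ s := by rw [hs, Set.mem_toFinset]; exact hx
    exact ⟨e ⟨x, hx'⟩, by simp [ι]⟩
  · rintro ⟨i, rfl⟩
    exact ⟨ι i, by rw [← Set.mem_toFinset, ← hs]; exact (e.symm i).2, rfl⟩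

/-- **a regular one-dimensional quotient of a regular stalk is a regular curve FRAME** (of some length `r ≥ 0`). [cite: Matsumura1987, Thm. 14.2] -/
theorem exists_curveFrame_of_isRegularLocalRing_quotient {Y : Scheme.{u}} (H : Y.IdealSheafData) (y : Y)
    [IsRegularLocalRing (Y.presheaf.stalk y)] (hle : stalkIdeal H y ≤ maximalIdeal _)
    [IsRegularLocalRing (Y.presheaf.stalk y ⧸ stalkIdeal H y)] (hdim : ringKrullDim (Y.presheaf.stalk y ⧸ stalkIdeal H y) = 1) :
    ∃ r : ℕ, CurveFrame H r y := by
  obtain ⟨r, w, hw, hJ⟩ := exists_isRsopPart_of_isRegularLocalRing_quotient hle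
  refine ⟨r, w, hw, hJ, ?_⟩
  have h := hw.ringKrullDim_quotient_add
  rw [← hJ, hdim] at h
  rw [← h, Nat.cast_succ, add_comm]

/-- a NON-ZERO ideal of a domain with one-dimensional quotient forces ring dimension `≥ 2`. [folklore] -/
theorem two_le_ringKrullDim_of_quotient_eq_one {R : Type*} [CommRing R] [IsDomain R] {J : Ideal R} (hJ0 : J ≠ ⊥)
    (h : ringKrullDim (R ⧸ J) = 1) : (2 : WithBot ℕ∞) ≤ ringKrullDim R := by
  obtain ⟨r, hrJ, hr0⟩ := Submodule.exists_mem_ne_zero_of_ne_bot hJ0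
  have h1 := ringKrullDim_succ_le_of_surjective (Ideal.Quotient.mk J) Ideal.Quotient.mk_surjective
    (mem_nonZeroDivisors_of_ne_zero hr0) (Ideal.Quotient.eq_zero_iff_mem.mpr hrJ)
  rw [h, one_add_one_eq_two] at h1
  exact h1

/-- in a forced tower of weight `n ≥ 1`, a hugged germ with one-dimensional quotient at stage `m` forces ring dimension `≥ 2` at EVERY
marked point (constancy of the ring dimension, `tower_ringKrullDim_pt_eq`). [folklore] -/
theorem two_le_ringKrullDim_pt (T : ForcedTower) (g : T.St 0 ⟶ Spec (.of k)) (hB : IsBase (T.St 0) g) {n : ℕ}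
    (hD : IsDatum n (T.D 0)) (hn : 1 ≤ n) {m : ℕ} {H : (T.St m).IdealSheafData} (hH : DivergentTowerClasses.HugsGerm T m H)
    (hdim : ringKrullDim ((T.St m).presheaf.stalk (T.pt m) ⧸ stalkIdeal H (T.pt m)) = 1) (i : ℕ) :
    (2 : WithBot ℕ∞) ≤ ringKrullDim ((T.St i).presheaf.stalk (T.pt i)) := by
  haveI := (tower_isLocallyNoetherian_isRegular T g hB m).1
  haveI : IsRegularLocalRing ((T.St m).presheaf.stalk (T.pt m)) := (tower_isBase T g hB m).isRegular _
  haveI : IsDomain ((T.St m).presheaf.stalk (T.pt m)) := isDomain_of_isRegularLocalRing _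
  have hne : stalkIdeal H (T.pt m) ≠ ⊥ := fun h0 => hH.1 (idealOrder_eq_top_of_stalkIdeal_eq_bot' _ _ h0)
  rw [tower_ringKrullDim_pt_eq T g hB hD hn i, ← tower_ringKrullDim_pt_eq T g hB hD hn m]
  exact two_le_ringKrullDim_of_quotient_eq_one hne hdim

end Bridge

/-! ## §159 (g44 · THE LOCATED RESIDUAL F OF THE PORT `hC`, THE CELLS AND THE EXACT CARVE).  F = `HuggedBranchResolution` — embedded
resolution of a hugged integral curve germ by the point blow-ups of a branch: KNOWN IN PRINT (the δ-invariant of a one-dimensional reduced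
local ring essentially of finite type drops under blowing up its closed point until the ring is regular; foreign rounds are local
isomorphisms) [cite: Liu2002, Prop. 8.1.26; Lem. 9.2.32], UNDECIDED in the tree.  The em-split of `PrimeCurveHugging` by «some followed
strict transform is a regular one-dimensional germ»: the EVENTUALLY REGULAR BRANCH cell is KILLED hypothesis-free for every class (Matsumura
bridge §158 + re-base §157 + LAW R §155), the SINGULAR BRANCH cell is the located residual; `curveLawAll_iff_g44 : MaxContactCut.CurveLawAll ↔
SingularBranchCurveLawAll` (exact) and `curveLawAll_of_huggedBranchResolution : HuggedBranchResolution → MaxContactCut.CurveLawAll`. -/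

section Residual

/-- **F = `HuggedBranchResolution`** (the located residual of the port `hC : MaxContactCut.CurveLawAll` after g44, typed over the lens-6
objects `SatelliteExitClasses.Branch` / `strictIter` / `HugsGerm`).  PRINT STATEMENT: along ANY branch (regular ambient germs of finite type over
a field; point blow-ups with regular centres through or off the followed point) that follows forever the germ `V(H) ∋ pt m` of an INTEGRAL
CURVE (`H_{pt m}` prime, `dim 𝒪_{pt m}/H_{pt m} = 1`), SOME followed strict transform is a REGULAR one-dimensional germ:
`𝒪_{pt (m+j)} / (strictIter B m H j)_{pt (m+j)}` is a regular local ring of dimension one.  Paper proof: the point rounds through the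
followed point are the blow-ups of the closed point of the (reduced, one-dimensional, essentially of finite type) curve germ followed by
localisation at a point of the fibre, and the δ-invariant drops at each of them until the germ is regular (Lipman 1978 §1; Liu 2002
Prop. 8.1.26 with Lemma 9.2.32; Stacks 0BI5/0BIC; CJS2020 Ch. 2 for the embedded version); foreign rounds do not change the germ.
KNOWN IN PRINT · UNDECIDED IN THE TREE.  HONEST HABITAT NOTE: F quantifies over ALL lens-6 branches hugging an integral curve germ — a
habitat LARGER than the residual cell below (which only concerns marked points of forced towers of weight `n ≥ 1` over a field of
characteristic `p`); F is the natural print statement, the cell is what the root needs. -/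
def HuggedBranchResolution : Prop :=
  ∀ (k : Type) [Field k] (B : SatelliteExitClasses.Branch k) (m : ℕ) (H : (B.St m).IdealSheafData),
    SatelliteExitClasses.HugsGerm B m H → (stalkIdeal H (B.pt m)).IsPrime →
    ringKrullDim ((B.St m).presheaf.stalk (B.pt m) ⧸ stalkIdeal H (B.pt m)) = 1 →
    ∃ j : ℕ, IsRegularLocalRing ((B.St (m + j)).presheaf.stalk (B.pt (m + j)) ⧸
        stalkIdeal (SatelliteExitClasses.strictIter B m H j) (B.pt (m + j))) ∧
      ringKrullDim ((B.St (m + j)).presheaf.stalk (B.pt (m + j)) ⧸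
        stalkIdeal (SatelliteExitClasses.strictIter B m H j) (B.pt (m + j))) = 1

end Residual

section Carve

open Summit.ResolutionOfSingularities.ResolutionOfSingularities.Theses

/-- CELL (DECIDED, killed below for every class and every weight `n ≥ 1`) · EVENTUALLY REGULAR BRANCH HUGGING: the tower hugs forever a germ
with one-dimensional quotient at stage `m` ONE of whose followed strict transforms is a REGULAR one-dimensional germ at the followed point. -/
def EventuallyRegularBranchHugging (T : ForcedTower) : Prop :=
  ∃ (m : ℕ) (H : (T.St m).IdealSheafData), DivergentTowerClasses.HugsGerm T m H ∧
    ringKrullDim ((T.St m).presheaf.stalk (T.pt m) ⧸ stalkIdeal H (T.pt m)) = 1 ∧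
    ∃ j : ℕ, IsRegularLocalRing ((T.St (m + j)).presheaf.stalk (T.pt (m + j)) ⧸
        stalkIdeal (DivergentTowerClasses.strictIter T m H j) (T.pt (m + j))) ∧
      ringKrullDim ((T.St (m + j)).presheaf.stalk (T.pt (m + j)) ⧸
        stalkIdeal (DivergentTowerClasses.strictIter T m H j) (T.pt (m + j))) = 1

/-- CELL (located residual of `hC` after g44) · SINGULAR BRANCH CURVE HUGGING: the tower hugs forever an INTEGRAL CURVE germ (`H_{pt m}` prime,
one-dimensional quotient) NONE of whose followed strict transforms is a regular one-dimensional germ at the followed point. -/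
def SingularBranchCurveHugging (T : ForcedTower) : Prop :=
  ∃ (m : ℕ) (H : (T.St m).IdealSheafData), DivergentTowerClasses.HugsGerm T m H ∧ (stalkIdeal H (T.pt m)).IsPrime ∧
    ringKrullDim ((T.St m).presheaf.stalk (T.pt m) ⧸ stalkIdeal H (T.pt m)) = 1 ∧
    ∀ j : ℕ, ¬ (IsRegularLocalRing ((T.St (m + j)).presheaf.stalk (T.pt (m + j)) ⧸
        stalkIdeal (DivergentTowerClasses.strictIter T m H j) (T.pt (m + j))) ∧
      ringKrullDim ((T.St (m + j)).presheaf.stalk (T.pt (m + j)) ⧸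
        stalkIdeal (DivergentTowerClasses.strictIter T m H j) (T.pt (m + j))) = 1)

/-- the located residual of the port `hC`, all weights: no forced tower of weight `n ≥ 1` is singular-branch curve hugging (over the landed
`DivergentTowerClasses.NoTower`). -/
def SingularBranchCurveLawAll : Prop := ∀ n : ℕ, 1 ≤ n → DivergentTowerClasses.NoTower n SingularBranchCurveHugging

/-- **re-base to a regular curve frame**: a hugged germ one of whose followed strict transforms is a regular curve frame of POSITIVE length
makes the tower REGULAR-CURVE HUGGING (re-base §157; the frame's first parameter is a non-zero member of the stalk). [NEW] -/
theorem regularCurveHugging_of_curveFrame_strictIter (T : ForcedTower) (g : T.St 0 ⟶ Spec (.of k)) (hB : IsBase (T.St 0) g)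
    {m : ℕ} {H : (T.St m).IdealSheafData} (hH : DivergentTowerClasses.HugsGerm T m H) {j r : ℕ}
    (hF : CurveFrame (DivergentTowerClasses.strictIter T m H j) (r + 1) (T.pt (m + j))) : RegularCurveHugging T := by
  refine ⟨m + j, r + 1, DivergentTowerClasses.strictIter T m H j, hF, ?_⟩
  have hfin : idealOrder (DivergentTowerClasses.strictIter T m H j) (T.pt (m + j)) ≠ ⊤ := by
    obtain ⟨w, hw, hspan, -⟩ := hF
    haveI : IsRegularLocalRing ((T.St (m + j)).presheaf.stalk (T.pt (m + j))) := hw.1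
    refine (idealOrder_lt_top_of_stalkIdeal_ne_bot ?_).ne
    rw [hspan]
    intro h0
    exact hw.ne_zero 0 (Ideal.span_singleton_eq_bot.mp (le_bot_iff.mp (h0 ▸ Ideal.span_mono (Set.singleton_subset_iff.mpr ⟨0, rfl⟩))))
  have h1 := hugsGerm_strictIter (toBranch T g hB) ((hugsGerm_toBranch T g hB m H).mpr hH) j
    (by rw [strictIter_toBranch]; exact hfin)
  rw [strictIter_toBranch] at h1
  exact (hugsGerm_toBranch T g hB (m + j) _).mp h1

/-- **THE DECIDED CELL AS A LAW (hypothesis-free, every class `P`, every weight `n ≥ 1`, every `p`, every field)**: NO forced tower is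
eventually-regular-branch hugging — Matsumura bridge (the regular one-dimensional followed germ is a regular curve frame; of positive length by
the dimension bookkeeping `dim 𝒪 ≥ 2`), re-base, LAW R (isolation kill of a hugged regular curve, lens-6 x-law + lens-4 `false_of_hugsTop`).
[NEW] -/
theorem noTower_eventuallyRegularBranchHugging {n : ℕ} (hn : 1 ≤ n) (P : ForcedTower → Prop) :
    DivergentTowerClasses.NoTower n fun T => P T ∧ EventuallyRegularBranchHugging T := by
  intro p hp k _ _ T g hB hD hE hT
  obtain ⟨-, m, H, hH, hdim, j, hreg, hdimj⟩ := hT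
  haveI := (tower_isLocallyNoetherian_isRegular T g hB (m + j)).1
  haveI : IsRegularLocalRing ((T.St (m + j)).presheaf.stalk (T.pt (m + j))) := (tower_isBase T g hB (m + j)).isRegular _
  haveI := hreg
  have hle : stalkIdeal (DivergentTowerClasses.strictIter T m H j) (T.pt (m + j)) ≤ maximalIdeal _ :=
    (mem_support_iff_stalkIdeal_le _ _).mp (hH.2 j)
  obtain ⟨r, hF⟩ := exists_curveFrame_of_isRegularLocalRing_quotient _ _ hle hdimj
  cases r with
  | zero =>
    obtain ⟨w, -, -, hd1⟩ := hF
    have h2 := two_le_ringKrullDim_pt T g hB hD hn hH hdim (m + j)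
    rw [hd1] at h2
    exact absurd h2 (by decide)
  | succ r =>
    exact noTower_regularCurveHugging n (fun _ => True) p hp k T g hB hD hE
      ⟨trivial, regularCurveHugging_of_curveFrame_strictIter T g hB hH hF⟩

/-- **THE CARVE at weight `n ≥ 1` (exact)**: no curve-hugging tower ⟺ no singular-branch curve-hugging tower (pigeonhole law §156, then the
em-split «some followed strict transform is a regular one-dimensional germ», the regular side killed by the LAW above). [NEW] -/
theorem noTower_curveHugging_iff {n : ℕ} (hn : 1 ≤ n) :
    DivergentTowerClasses.NoTower n CurveHugging ↔ DivergentTowerClasses.NoTower n SingularBranchCurveHugging := by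
  refine ⟨fun h p hp k _ _ T g hB hD hE hS => ?_, fun h p hp k _ _ T g hB hD hE hC => ?_⟩
  · obtain ⟨m, H, hH, hP, hdim, -⟩ := hS
    exact h p hp k T g hB hD hE (curveHugging_of_primeCurveHugging T ⟨m, H, hH, hP, hdim⟩)
  · obtain ⟨m, H, hH, hP, hdim⟩ := primeCurveHugging_of_curveHugging T g hB hC
    by_cases hreg : ∃ j : ℕ, IsRegularLocalRing ((T.St (m + j)).presheaf.stalk (T.pt (m + j)) ⧸
        stalkIdeal (DivergentTowerClasses.strictIter T m H j) (T.pt (m + j))) ∧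
      ringKrullDim ((T.St (m + j)).presheaf.stalk (T.pt (m + j)) ⧸
        stalkIdeal (DivergentTowerClasses.strictIter T m H j) (T.pt (m + j))) = 1
    · exact noTower_eventuallyRegularBranchHugging hn (fun _ => True) p hp k T g hB hD hE ⟨trivial, m, H, hH, hdim, hreg⟩
    · push Not at hreg
      exact h p hp k T g hB hD hE ⟨m, H, hH, hP, hdim, fun j => not_and.mpr (hreg j)⟩

/-- `CurveLaw n ⟺ no curve-hugging tower of weight n` (the descent data are vacuous data on an empty class). [folklore] -/
theorem curveLaw_iff_noTower (n : ℕ) : CurveLaw n ↔ DivergentTowerClasses.NoTower n CurveHugging :=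
  ⟨curve_of_curveLaw, fun h p hp k _ _ T g hB hD hE hC => (h p hp k T g hB hD hE hC).elim⟩

/-- **THE EXACT CARVE OF THE PORT `hC` (g44)**: `MaxContactCut.CurveLawAll ⟺ SingularBranchCurveLawAll` — zero binders, both directions. [NEW] -/
theorem curveLawAll_iff_g44 : MaxContactCut.CurveLawAll ↔ SingularBranchCurveLawAll :=
  ⟨fun h n hn => (noTower_curveHugging_iff hn).mp ((curveLaw_iff_noTower n).mp (h n hn)),
    fun h n hn => (curveLaw_iff_noTower n).mpr ((noTower_curveHugging_iff hn).mpr (h n hn))⟩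

/-- **F decides the residual cell**: `HuggedBranchResolution → SingularBranchCurveLawAll` (through the adapter `toBranch`). [NEW] -/
theorem singularBranchCurveLawAll_of_huggedBranchResolution (hF : HuggedBranchResolution) : SingularBranchCurveLawAll := by
  intro n _ p _ k _ _ T g hB _ _ hS
  obtain ⟨m, H, hH, hP, hdim, hnot⟩ := hS
  obtain ⟨j, hreg, hdimj⟩ := hF k (toBranch T g hB) m H ((hugsGerm_toBranch T g hB m H).mpr hH) hP hdim
  rw [strictIter_toBranch] at hreg hdimj
  exact hnot j ⟨hreg, hdimj⟩

/-- **THE PORT `hC` FROM F**: `HuggedBranchResolution → MaxContactCut.CurveLawAll`. [NEW] -/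
theorem curveLawAll_of_huggedBranchResolution (hF : HuggedBranchResolution) : MaxContactCut.CurveLawAll :=
  curveLawAll_iff_g44.mpr (singularBranchCurveLawAll_of_huggedBranchResolution hF)

/-- the weight-`n` port from F. [NEW] -/
theorem curveLaw_of_huggedBranchResolution (hF : HuggedBranchResolution) {n : ℕ} (hn : 1 ≤ n) : CurveLaw n :=
  curveLawAll_of_huggedBranchResolution hF n hn

/-- `NoEventuallyRegularBranchHuggingTowers`: all weights, the bare cell. -/
def NoEventuallyRegularBranchHuggingTowers : Prop :=
  ∀ n : ℕ, 1 ≤ n → DivergentTowerClasses.NoTower n EventuallyRegularBranchHugging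

/-- the decided cell, all weights, ZERO binders. [NEW] -/
theorem noEventuallyRegularBranchHuggingTowers_holds : NoEventuallyRegularBranchHuggingTowers := fun _ hn p hp k _ _ T g hB hD hE hT =>
  noTower_eventuallyRegularBranchHugging hn (fun _ => True) p hp k T g hB hD hE ⟨trivial, hT⟩

end Carve

end Summit.ResolutionOfSingularities.ResolutionOfSingularities.Theorems.HugValuationCut
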